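import Summits.RiemannHypothesis.RiemannHypothesis.Theses.SpectralTrace
import HarnessLib

/-!
# Crux `SpectralThesis` (stmt-RiemannHypothesis-0187), line `Sketch` — stub `stub_sumByParts`

First-order Euler–Maclaurin summation on a warped lattice. Let `Φ` be a `C¹` phase with
`Φ' = dΦ ≥ c > 0` (so `Φ` is a strictly increasing bijection of `ℝ`) of at most linear growth,
`Ψ` its inverse (`Φ (Ψ y) = y`), and `F ∈ C¹(ℝ → ℂ)` with `F, F' = O((1 + t²)⁻²)`. Then
`Σ_{n ∈ ℤ} F (Ψ n) = ∫ F Φ' + ∫ F' · fract (Φ)` as a `HasSum` over `ℤ`.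

Proof. On the cell `[Ψ m, Ψ (m+1)]` one has `fract (Φ s) = Φ s - m` away from the right
endpoint, so by the fundamental theorem of calculus applied to `F · (Φ - m)` the cell integral of
`F Φ' + F' fract Φ` equals `F (Ψ (m+1))`. Summing the cells from `Ψ (-N)` to `Ψ N` and letting
`N → ∞` (the integrand is absolutely integrable, the endpoints tend to `∓∞`) identifies the sum;
unconditional convergence over `ℤ` follows since `‖F (Ψ (m+1))‖` is bounded by the cell integral
of `‖F Φ' + F' fract Φ‖`, whose partial sums are bounded by the total integral.
-/

noncomputable section

set_option linter.dupNamespace false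

open Complex Set MeasureTheory Filter
open scoped Real Topology

namespace Summit.RiemannHypothesis.RiemannHypothesis.Theorems.SpectralThesis.Sketch

namespace SumByParts

/-- Two-sided telescoping of adjacent interval integrals over the cells `[t k, t (k+1)]`,
`-N ≤ k < N`, split into the nonnegative and the negative cells. [folklore] -/
theorem sum_cells_two_sided {E : Type*} [NormedAddCommGroup E] [NormedSpace ℝ E]
    (t : ℝ → ℝ) (φ : ℝ → E) (hφ : ∀ a b, IntervalIntegrable φ volume a b) (N : ℕ) :
    (∑ k ∈ Finset.range N, ∫ x in t k..t (k + 1), φ x) +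
      ∑ k ∈ Finset.range N, ∫ x in t (-((k : ℝ) + 1))..t (-(k : ℝ)), φ x =
      ∫ x in t (-(N : ℝ))..t N, φ x := by
  induction N with
  | zero => simp
  | succ N ih =>
    rw [Finset.sum_range_succ, Finset.sum_range_succ, add_add_add_comm, ih]
    push_cast
    have h1 := intervalIntegral.integral_add_adjacent_intervals
      (hφ (t (-((N : ℝ) + 1))) (t (-(N : ℝ)))) (hφ (t (-(N : ℝ))) (t N))
    have h2 := intervalIntegral.integral_add_adjacent_intervals
      (hφ (t (-((N : ℝ) + 1))) (t N)) (hφ (t N) (t ((N : ℝ) + 1)))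
    rw [← h2, ← h1]
    abel

/-- The cell identity: for an integer `m`, on `[Ψ m, Ψ (m+1)]` the integral of
`F Φ' + F' · fract Φ` equals `F (Ψ (m+1))` (integration by parts with `fract Φ = Φ - m` on the
open cell). [folklore] -/
theorem cell_integral (Φ dΦ Ψ : ℝ → ℝ) (hΦ : ∀ t, HasDerivAt Φ (dΦ t) t) (hdΦ : Continuous dΦ)
    (hΦm : StrictMono Φ) (hΨ : ∀ y, Φ (Ψ y) = y) (hΨm : Monotone Ψ)
    (F dF : ℝ → ℂ) (hF : ∀ t, HasDerivAt F (dF t) t) (hdF : Continuous dF)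
    (m : ℤ) {y y' : ℝ} (hy : (m : ℝ) = y) (hy' : y' = y + 1) :
    ∫ x in Ψ y..Ψ y', (F x * (dΦ x : ℂ) + dF x * ((Int.fract (Φ x) : ℝ) : ℂ)) = F (Ψ y') := by
  subst hy hy'
  have hab : Ψ m ≤ Ψ (m + 1) := hΨm (by linarith)
  have hΦc : Continuous Φ := continuous_iff_continuousAt.2 fun x => (hΦ x).continuousAt
  have hFc : Continuous F := continuous_iff_continuousAt.2 fun x => (hF x).continuousAt
  have hu : ∀ x, HasDerivAt (fun x => F x * ((Φ x - m : ℝ) : ℂ))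
      (dF x * ((Φ x - m : ℝ) : ℂ) + F x * ((dΦ x : ℝ) : ℂ)) x :=
    fun x => (hF x).mul ((hΦ x).sub_const _).ofReal_comp
  have hint : IntervalIntegrable (fun x => dF x * ((Φ x - m : ℝ) : ℂ) + F x * ((dΦ x : ℝ) : ℂ))
      volume (Ψ m) (Ψ (m + 1)) :=
    ((hdF.mul (continuous_ofReal.comp (hΦc.sub continuous_const))).add
      (hFc.mul (continuous_ofReal.comp hdΦ))).intervalIntegrable _ _
  have hftc := intervalIntegral.integral_eq_sub_of_hasDerivAt (fun x _ => hu x) hint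
  have hΦa : Φ (Ψ m) = m := hΨ _
  have hΦb : Φ (Ψ (m + 1)) = m + 1 := hΨ _
  calc ∫ x in Ψ m..Ψ (m + 1), (F x * (dΦ x : ℂ) + dF x * ((Int.fract (Φ x) : ℝ) : ℂ))
      = ∫ x in Ψ m..Ψ (m + 1), (dF x * ((Φ x - m : ℝ) : ℂ) + F x * ((dΦ x : ℝ) : ℂ)) := by
        rw [intervalIntegral.integral_of_le hab, intervalIntegral.integral_of_le hab,
          integral_Ioc_eq_integral_Ioo, integral_Ioc_eq_integral_Ioo]
        refine setIntegral_congr_fun measurableSet_Ioo fun x hx => ?_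
        have h1 : (m : ℝ) < Φ x := by rw [← hΦa]; exact hΦm hx.1
        have h2 : Φ x < m + 1 := by rw [← hΦb]; exact hΦm hx.2
        have h3 : Int.fract (Φ x) = Φ x - m := by
          rw [Int.fract_eq_iff]; exact ⟨by linarith, by linarith, m, by ring⟩
        simp only [h3]
        ring
    _ = F (Ψ (m + 1)) := by
        rw [hftc, hΦa, hΦb]
        simp

end SumByParts

/-- **STUB · `stub_sumByParts`** — first-order Euler–Maclaurin on a warped lattice: for a `C¹` phase
`Φ` with `Φ' ≥ c > 0` of linear growth and right inverse `Ψ`, and `F ∈ C¹` with `F, F' = O((1+t²)⁻²)`,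
`Σ_{n ∈ ℤ} F(Ψ n) = ∫ F Φ' + ∫ F' · fract(Φ)` (unconditionally, as a `HasSum` over `ℤ`). [folklore] -/
theorem stub_sumByParts :
    ∀ (Φ dΦ Ψ : ℝ → ℝ) (c D : ℝ), 0 < c →
      (∀ t, HasDerivAt Φ (dΦ t) t) → Continuous dΦ → (∀ t, c ≤ dΦ t) →
      (∀ t, dΦ t ≤ D * (1 + |t|)) → (∀ y, Φ (Ψ y) = y) →
      ∀ (F dF : ℝ → ℂ) (C : ℝ), (∀ t, HasDerivAt F (dF t) t) → Continuous dF →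
        (∀ t, ‖F t‖ ≤ C / (1 + t ^ 2) ^ 2) → (∀ t, ‖dF t‖ ≤ C / (1 + t ^ 2) ^ 2) →
        HasSum (fun n : ℤ => F (Ψ n))
          ((∫ t : ℝ, F t * (dΦ t : ℂ)) + ∫ t : ℝ, dF t * ((Int.fract (Φ t) : ℝ) : ℂ)) := by
  intro Φ dΦ Ψ c D hc hΦ hdΦ hcΦ hDΦ hΨ F dF C hF hdF hFb hdFb
  -- monotonicity of the phase and of its inverse
  have hΦm : StrictMono Φ := strictMono_of_hasDerivAt_pos hΦ fun x => hc.trans_le (hcΦ x)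
  have hΨΦ : ∀ x, Ψ (Φ x) = x := fun x => hΦm.injective (hΨ (Φ x))
  have hΨm : StrictMono Ψ := fun y₁ y₂ h => hΦm.lt_iff_lt.mp (by rwa [hΨ, hΨ])
  have hΦc : Continuous Φ := continuous_iff_continuousAt.2 fun x => (hΦ x).continuousAt
  have hFc : Continuous F := continuous_iff_continuousAt.2 fun x => (hF x).continuousAt
  have hC : 0 ≤ C := by
    have h := hFb 0
    norm_num at h
    exact (norm_nonneg _).trans h
  have hD : 0 ≤ D := by
    have h := (hcΦ 0).trans (hDΦ 0)
    norm_num at h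
    linarith
  -- integrability of the two integrands
  have hI₁ : Integrable (fun x => F x * (dΦ x : ℂ)) := by
    refine (integrable_inv_one_add_sq.const_mul (2 * C * D)).mono'
      (hFc.mul (continuous_ofReal.comp hdΦ)).aestronglyMeasurable
      (Eventually.of_forall fun x => ?_)
    have h0 : 0 < dΦ x := hc.trans_le (hcΦ x)
    have habs : |x| ≤ 1 + x ^ 2 := by nlinarith [sq_nonneg (|x| - 1), sq_abs x, abs_nonneg x]
    rw [norm_mul, Complex.norm_of_nonneg h0.le]
    calc ‖F x‖ * dΦ x ≤ C / (1 + x ^ 2) ^ 2 * (D * (1 + |x|)) :=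
          mul_le_mul (hFb x) (hDΦ x) h0.le (by positivity)
      _ = C * D * (1 + |x|) / (1 + x ^ 2) ^ 2 := by ring
      _ ≤ 2 * C * D * (1 + x ^ 2) / (1 + x ^ 2) ^ 2 :=
          div_le_div_of_nonneg_right (by
            nlinarith [mul_nonneg (mul_nonneg hC hD) (sub_nonneg.2 habs),
              mul_nonneg (mul_nonneg hC hD) (sq_nonneg x)]) (by positivity)
      _ = 2 * C * D * (1 + x ^ 2)⁻¹ := by
          have hx : (1 + x ^ 2) ≠ 0 := by positivity
          field_simp
  have hI₂ : Integrable (fun x => dF x * ((Int.fract (Φ x) : ℝ) : ℂ)) := by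
    have hmeas : Measurable fun x => ((Int.fract (Φ x) : ℝ) : ℂ) :=
      (hΦc.measurable.fract).complex_ofReal
    refine (integrable_inv_one_add_sq.const_mul C).mono'
      (hdF.aestronglyMeasurable.mul hmeas.aestronglyMeasurable)
      (Eventually.of_forall fun x => ?_)
    rw [norm_mul, Complex.norm_of_nonneg (Int.fract_nonneg _)]
    calc ‖dF x‖ * Int.fract (Φ x) ≤ C / (1 + x ^ 2) ^ 2 * 1 :=
          mul_le_mul (hdFb x) (Int.fract_lt_one _).le (Int.fract_nonneg _) (by positivity)
      _ ≤ C * (1 + x ^ 2)⁻¹ := by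
          rw [mul_one, ← div_eq_mul_inv]
          exact div_le_div_of_nonneg_left hC (by positivity)
            (le_self_pow₀ (le_add_of_nonneg_right (sq_nonneg x)) two_ne_zero)
  obtain ⟨f, hf⟩ : ∃ f : ℝ → ℂ,
      f = fun x => F x * (dΦ x : ℂ) + dF x * ((Int.fract (Φ x) : ℝ) : ℂ) := ⟨_, rfl⟩
  have hfi : Integrable f := by rw [hf]; exact hI₁.add hI₂
  have hfii : ∀ a b, IntervalIntegrable f volume a b := fun a b => hfi.intervalIntegrable
  -- the cell identity and the resulting bound
  have cell : ∀ (m : ℤ) {y y' : ℝ}, (m : ℝ) = y → y' = y + 1 →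
      ∫ x in Ψ y..Ψ y', f x = F (Ψ y') := by
    intro m y y' hy hy'
    rw [hf]
    exact SumByParts.cell_integral Φ dΦ Ψ hΦ hdΦ hΦm hΨ hΨm.monotone F dF hF hdF m hy hy'
  have cellb : ∀ (m : ℤ) {y y' : ℝ}, (m : ℝ) = y → y' = y + 1 →
      ‖F (Ψ y')‖ ≤ ∫ x in Ψ y..Ψ y', ‖f x‖ := by
    intro m y y' hy hy'
    rw [← cell m hy hy']
    exact intervalIntegral.norm_integral_le_integral_norm (hΨm.monotone (by rw [hy']; linarith))
  -- endpoints of the windows and the limit of the window integrals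
  have htop : Tendsto (fun N : ℕ => Ψ N) atTop atTop :=
    (hΨm.monotone.tendsto_atTop_atTop fun b => ⟨Φ b, (hΨΦ b).ge⟩).comp
      tendsto_natCast_atTop_atTop
  have hbot : Tendsto (fun N : ℕ => Ψ (-(N : ℝ))) atTop atBot :=
    (hΨm.monotone.tendsto_atBot_atBot fun b => ⟨Φ b, (hΨΦ b).le⟩).comp
      (tendsto_neg_atTop_atBot.comp tendsto_natCast_atTop_atTop)
  have hlim : Tendsto (fun N : ℕ => ∫ x in Ψ (-(N : ℝ))..Ψ N, f x) atTop (𝓝 (∫ x, f x)) :=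
    intervalIntegral_tendsto_integral hfi hbot htop
  -- the lattice sums over the windows
  set g : ℤ → ℂ := fun n => F (Ψ n) with hg_def
  have hsum : ∀ N : ℕ, (∑ k ∈ Finset.range N, g (k + 1)) + ∑ k ∈ Finset.range N, g (-k) =
      ∫ x in Ψ (-(N : ℝ))..Ψ N, f x := by
    intro N
    rw [← SumByParts.sum_cells_two_sided Ψ f hfii N]
    congr 1
    · refine Finset.sum_congr rfl fun k _ => ?_
      rw [cell k (y := k) (by push_cast; ring) rfl]
      simp [hg_def]
    · refine Finset.sum_congr rfl fun k _ => ?_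
      rw [cell (-(k + 1)) (y := -((k : ℝ) + 1)) (y' := -(k : ℝ)) (by push_cast; ring) (by ring)]
      simp [hg_def]
  have hbound : ∀ N : ℕ, (∑ k ∈ Finset.range N, ‖g (k + 1)‖) + ∑ k ∈ Finset.range N, ‖g (-k)‖ ≤
      ∫ x, ‖f x‖ := by
    intro N
    have hfn : ∀ a b, IntervalIntegrable (fun x => ‖f x‖) volume a b :=
      fun a b => hfi.norm.intervalIntegrable
    have hNN : Ψ (-(N : ℝ)) ≤ Ψ N := hΨm.monotone (by linarith [N.cast_nonneg (α := ℝ)])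
    calc (∑ k ∈ Finset.range N, ‖g (k + 1)‖) + ∑ k ∈ Finset.range N, ‖g (-k)‖
        ≤ (∑ k ∈ Finset.range N, ∫ x in Ψ k..Ψ (k + 1), ‖f x‖) +
          ∑ k ∈ Finset.range N, ∫ x in Ψ (-((k : ℝ) + 1))..Ψ (-(k : ℝ)), ‖f x‖ := by
          refine add_le_add (Finset.sum_le_sum fun k _ => ?_) (Finset.sum_le_sum fun k _ => ?_)
          · have h := cellb k (y := k) (by push_cast; ring) rfl
            simpa [hg_def] using h
          · have h := cellb (-(k + 1)) (y := -((k : ℝ) + 1)) (y' := -(k : ℝ))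
              (by push_cast; ring) (by ring)
            simpa [hg_def] using h
      _ = ∫ x in Ψ (-(N : ℝ))..Ψ N, ‖f x‖ :=
          SumByParts.sum_cells_two_sided Ψ (fun x => ‖f x‖) hfn N
      _ = ∫ x in Ioc (Ψ (-(N : ℝ))) (Ψ N), ‖f x‖ := intervalIntegral.integral_of_le hNN
      _ ≤ ∫ x, ‖f x‖ :=
          setIntegral_le_integral hfi.norm (Eventually.of_forall fun x => norm_nonneg _)
  -- unconditional summability of the two halves
  have hs₁ : Summable fun k : ℕ => g (k + 1) := by
    refine .of_norm (summable_of_sum_range_le (c := ∫ x, ‖f x‖) (fun _ => norm_nonneg _) fun N => ?_)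
    exact le_trans (le_add_of_nonneg_right (Finset.sum_nonneg fun _ _ => norm_nonneg _))
      (hbound N)
  have hs₂ : Summable fun k : ℕ => g (-k) := by
    refine .of_norm (summable_of_sum_range_le (c := ∫ x, ‖f x‖) (fun _ => norm_nonneg _) fun N => ?_)
    exact le_trans (le_add_of_nonneg_left (Finset.sum_nonneg fun _ _ => norm_nonneg _))
      (hbound N)
  have hs₁' : Summable fun k : ℕ => g k := by
    rw [← summable_nat_add_iff 1]
    exact_mod_cast hs₁
  obtain ⟨a, ha⟩ := hs₁'
  obtain ⟨b, hb⟩ := hs₂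
  -- identification of the sum
  have hlim2 : Tendsto
      (fun N : ℕ => (∑ k ∈ Finset.range (N + 1), g k) + ∑ k ∈ Finset.range N, g (-k))
      atTop (𝓝 (g 0 + ∫ x, f x)) := by
    have h : (fun N : ℕ => (∑ k ∈ Finset.range (N + 1), g k) + ∑ k ∈ Finset.range N, g (-k)) =
        fun N : ℕ => g 0 + ∫ x in Ψ (-(N : ℝ))..Ψ N, f x := by
      funext N
      rw [Finset.sum_range_succ', ← hsum N]
      push_cast
      ring
    rw [h]
    exact tendsto_const_nhds.add hlim
  have hab : a + b = g 0 + ∫ x, f x :=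
    tendsto_nhds_unique
      (((tendsto_add_atTop_iff_nat 1).mpr ha.tendsto_sum_nat).add hb.tendsto_sum_nat) hlim2
  have key := HasSum.of_nat_of_neg ha hb
  have e : ∫ x, f x =
      (∫ t : ℝ, F t * (dΦ t : ℂ)) + ∫ t : ℝ, dF t * ((Int.fract (Φ t) : ℝ) : ℂ) := by
    rw [← integral_add hI₁ hI₂, hf]
  rw [hab, add_sub_cancel_left, e] at key
  exact key

end Summit.RiemannHypothesis.RiemannHypothesis.Theorems.SpectralThesis.Sketch

end
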